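import Mathlib
import HarnessLib
import Summits.Ventures.LatticeQCDFlow.Scoring.RegenerativeVarianceEstimator

/-!
# The regenerative estimator at the CLT scale: `P(|Â_R − π(f)| ≥ s) ≤ 4(ε σ²_f/s² + 1 − ε)/R` with
# `σ²_f` the Green–Kubo ASYMPTOTIC VARIANCE; and `0 ≤ σ²_f ≤ (2C)²(2 − ε)/ε` for every minorised kernel

HONEST FRAMING: exact (Metropolis-corrected) sampling algorithms for lattice gauge theory;
figures of merit are autocorrelation/cost numbers at stated couplings and volumes; no
continuum-physics claim.

Venture `LatticeQCDFlow` (cell pub-lqcd), topic `Scoring`; FANOUT row 8 (`s0-cpn-nemc`, GEN-17).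
NEW WORK of the cell, not a published result; no definition is introduced.  Notation of
`Scoring/RegenerativeEstimator.lean`: tours `1..R` from ANY start, `Â_R = Σ Y_i / Σ N_i`,
`σ²_f := ∫ f̄² dπ + 2 Σ_{k≥1} ∫ f̄ K^k f̄ dπ` (Green–Kubo).  `Scoring/RegenerativeEstimatorSharp.lean`
(GEN-16) certified `P(s ≤ |Â_R − π(f)|) ≤ 4((2−ε)(2C)²/s² + (1−ε))/R` with the CRUDE second moment
`E[Z_1²] ≤ (2C)²(2−ε)/ε²`, and recorded as NOT CLAIMED "the CLT's variance-sensitive radius".  With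
GEN-17's identity `ε E_ν̂[Z_0²] = σ²_f` for every minorising law (`Scoring/TourVarianceGeneral.lean`)
and the exact diagonal `E[Z_{i+1}²] = E_ν̂[Z_0²]` the same two-Chebyshev argument gives the
VARIANCE-SENSITIVE certificate `P(s ≤ |Â_R − π(f)|) ≤ 4(ε σ²_f/s² + (1−ε))/R`: with `n ≈ R/ε` samples
this is Chebyshev at the CLT variance `σ²_f/n`, up to the factor `4` and the tour-count term
`4(1−ε)/R` — CLT-free, any start, any minorising law.  By-products: `σ²_f = ε E[Z_0²] ≥ 0` (the
Green–Kubo sum of a minorised kernel is nonnegative — not visible from the series) and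
`σ²_f ≤ (2C)²(2−ε)/ε` (an explicit ceiling on the asymptotic variance from the minorisation alone).
Printed counterpart NAMED ONLY: the regenerative CLT `√R(Â_R − π f) ⇒ N(0, E[Z_1²]/E[N_1]²)`
(Mykland–Tierney–Yu 1995 Thm 1; Hobert–Jones–Presnell–Rosenthal 2002 §2; Meyn–Tweedie 1993
Thm 17.3.6) — here a finite-`R` Chebyshev form; nothing is cited as a fact.

## Content (`e = ε.toReal`; `0 < ε < 1`; `π` invariant; `|f| ≤ C`; `σ²_f` as displayed)

* **`asymptoticVariance_nonneg_minorised`**, **`asymptoticVariance_le_minorised`** —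
  `0 ≤ σ²_f ≤ (2C)²(2 − e)/e`;
* **`regenerative_estimator_confidence_sigma`** — any start, `R ≥ 1`, `s > 0`:
  `P(s ≤ |Σ_{i=1}^R Y_i / Σ_{i=1}^R N_i − π(f)|) ≤ 4 (e σ²_f/s² + (1 − e)) / R`.

NOT CLAIMED: the factor `4` is not optimal; no CLT; any `ε` of a concrete sampler.
-/

noncomputable section

namespace Summit.Ventures.LatticeQCDFlow.Scoring

open MeasureTheory ProbabilityTheory Filter Finset Preorder Literature.Probability.MarkovChains
open scoped ENNReal

section Sigma

variable {Ω : Type*} [MeasurableSpace Ω]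
  {κ : Kernel Ω Ω} [IsMarkovKernel κ] {ν : Measure Ω} [IsProbabilityMeasure ν] {ε : ℝ≥0∞}

/-- **THE GREEN–KUBO ASYMPTOTIC VARIANCE OF A MINORISED KERNEL IS NONNEGATIVE**: `π` invariant,
`κ(x, ·) ≥ ε ν` (`0 < ε < 1`), `|f| ≤ C` measurable:
`0 ≤ ∫ f̄² dπ + 2 ∑' k, ∫ f̄ (kop κ)^[k+1] f̄ dπ` (it is `ε E_ν̂[Z_0²]` for any split chain). -/
theorem asymptoticVariance_nonneg_minorised {π : Measure Ω} [IsProbabilityMeasure π]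
    (hπ : Kernel.Invariant κ π) (hmin : ∀ x {B : Set Ω}, MeasurableSet B → ε * ν B ≤ κ x B)
    (hε0 : 0 < ε) (hε : ε < 1) {f : Ω → ℝ} (hf : Measurable f) {C : ℝ} (hC : ∀ x, |f x| ≤ C) :
    0 ≤ (∫ y, (f y - ∫ z, f z ∂π) ^ 2 ∂π)
        + 2 * ∑' k, ∫ y, (f y - ∫ z, f z ∂π) * (kop κ)^[k + 1] (fun y => f y - ∫ z, f z ∂π) y ∂π := by
  obtain ⟨κs, hκsM, hκs⟩ := exists_splitKernel (κ := κ) (ν := ν) (hmin := hmin) hε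
  rw [← splitChain_fresh_sq_centredTourSum_eq_greenKubo κs (κ := κ) (ν := ν) (hmin := hmin) hπ hε0 hε
    hκs hf hC]
  exact mul_nonneg ENNReal.toReal_nonneg (integral_nonneg fun x => sq_nonneg _)

/-- **AN EXPLICIT CEILING ON THE ASYMPTOTIC VARIANCE FROM THE MINORISATION**:
`∫ f̄² dπ + 2 ∑' k, ∫ f̄ (kop κ)^[k+1] f̄ dπ ≤ (2C)² (2 − e)/e`. -/
theorem asymptoticVariance_le_minorised {π : Measure Ω} [IsProbabilityMeasure π]
    (hπ : Kernel.Invariant κ π) (hmin : ∀ x {B : Set Ω}, MeasurableSet B → ε * ν B ≤ κ x B)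
    (hε0 : 0 < ε) (hε : ε < 1) {f : Ω → ℝ} (hf : Measurable f) {C : ℝ} (hC : ∀ x, |f x| ≤ C) :
    (∫ y, (f y - ∫ z, f z ∂π) ^ 2 ∂π)
        + 2 * ∑' k, ∫ y, (f y - ∫ z, f z ∂π) * (kop κ)^[k + 1] (fun y => f y - ∫ z, f z ∂π) y ∂π
      ≤ (2 * C) ^ 2 * (2 - ε.toReal) / ε.toReal := by
  obtain ⟨κs, hκsM, hκs⟩ := exists_splitKernel (κ := κ) (ν := ν) (hmin := hmin) hε
  haveI hνt : IsProbabilityMeasure (ν.map (fun y : Ω => (y, true))) :=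
    Measure.isProbabilityMeasure_map (measurable_tagCoin true).aemeasurable
  have he0 : 0 < ε.toReal := ENNReal.toReal_pos hε0.ne' (ne_top_of_lt hε)
  obtain ⟨hg, hCg, -⟩ := centred_observable_bounds π hf hC
  rw [← splitChain_fresh_sq_centredTourSum_eq_greenKubo κs (κ := κ) (ν := ν) (hmin := hmin) hπ hε0 hε
    hκs hf hC]
  have h := (splitChain_fresh_sq_tourSum_le κs (ν.map (fun y : Ω => (y, true))) (κ := κ) (ν := ν)
    (hmin := hmin) hε0 hε hκs hg hCg).2
  calc ε.toReal * _ ≤ ε.toReal * ((2 * C) ^ 2 * ((2 - ε.toReal) / ε.toReal ^ 2)) :=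
        mul_le_mul_of_nonneg_left h he0.le
    _ = (2 * C) ^ 2 * (2 - ε.toReal) / ε.toReal := by field_simp

variable {hmin : ∀ x {B : Set Ω}, MeasurableSet B → ε * ν B ≤ κ x B}
  (κs : Kernel (Ω × Bool) (Ω × Bool)) [IsMarkovKernel κs]
  (μs : Measure (Ω × Bool)) [IsProbabilityMeasure μs]

/-- **THE REGENERATIVE ESTIMATOR'S ERROR BAR AT THE CLT SCALE (variance-sensitive, CLT-free).**
`π` invariant, `κ(x, ·) ≥ ε ν` with `0 < ε < 1`, `|f| ≤ C` measurable, any initial law, `R ≥ 1`, `s > 0`,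
`σ²_f = ∫ f̄² dπ + 2 ∑' k, ∫ f̄ (kop κ)^[k+1] f̄ dπ`:
`P(s ≤ |Σ_{i=1}^R Y_i / Σ_{i=1}^R N_i − π(f)|) ≤ 4 (e σ²_f / s² + (1 − e)) / R`. -/
theorem regenerative_estimator_confidence_sigma {π : Measure Ω} [IsProbabilityMeasure π]
    (hπ : Kernel.Invariant κ π) (hε0 : 0 < ε) (hε : ε < 1)
    (hκs : ∀ p, κs p = (ε • ν).map (fun y : Ω => (y, true))
      + ((1 - ε) • Doeblin.residualKernel κ ν ε hmin p.1).map (fun y : Ω => (y, false)))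
    {f : Ω → ℝ} (hf : Measurable f) {C : ℝ} (hC : ∀ x, |f x| ≤ C) {R : ℕ} (hR : 0 < R)
    {s : ℝ} (hs : 0 < s) :
    (Kernel.trajMeasure (X := fun _ : ℕ => Ω × Bool) μs
        (fun n : ℕ => κs.comap (fun h : (i : ↥(Finset.Iic n)) → Ω × Bool =>
          h ⟨n, Finset.mem_Iic.2 le_rfl⟩) (measurable_pi_apply _))).real
      {x | s ≤ |(∑ i ∈ Finset.range R, ∑' u, (if (∑ s ∈ Finset.range u,
            (if (x (s + 1)).2 then (1 : ℕ) else 0)) = i + 1 then (1 : ℝ) else 0) * f (x u).1)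
          / (∑ i ∈ Finset.range R, ∑' u, (if (∑ s ∈ Finset.range u,
            (if (x (s + 1)).2 then (1 : ℕ) else 0)) = i + 1 then (1 : ℝ) else 0))
          - ∫ z, f z ∂π|}
      ≤ 4 * (ε.toReal * ((∫ y, (f y - ∫ z, f z ∂π) ^ 2 ∂π)
          + 2 * ∑' k, ∫ y, (f y - ∫ z, f z ∂π) * (kop κ)^[k + 1] (fun y => f y - ∫ z, f z ∂π) y ∂π)
          / s ^ 2 + (1 - ε.toReal)) / R := by
  haveI hνt : IsProbabilityMeasure (ν.map (fun y : Ω => (y, true))) :=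
    Measure.isProbabilityMeasure_map (measurable_tagCoin true).aemeasurable
  rw [← splitChain_fresh_sq_centredTourSum_eq_greenKubo κs (κ := κ) (ν := ν) (hmin := hmin) hπ hε0 hε
    hκs hf hC]
  set P := Kernel.trajMeasure (X := fun _ : ℕ => Ω × Bool) μs
      (fun n : ℕ => κs.comap (fun h : (i : ↥(Finset.Iic n)) → Ω × Bool =>
        h ⟨n, Finset.mem_Iic.2 le_rfl⟩) (measurable_pi_apply _)) with hP
  set Pν := Kernel.trajMeasure (X := fun _ : ℕ => Ω × Bool) (ν.map (fun y : Ω => (y, true)))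
      (fun n : ℕ => κs.comap (fun h : (i : ↥(Finset.Iic n)) → Ω × Bool =>
        h ⟨n, Finset.mem_Iic.2 le_rfl⟩) (measurable_pi_apply _)) with hPν
  set c := ∫ z, f z ∂π with hc
  set v := ∫ y, (∑' u, (if (∑ s ∈ Finset.range u, (if (y (s + 1)).2 then (1 : ℕ) else 0)) = 0
      then (1 : ℝ) else 0) * (f (y u).1 - c)) ^ 2 ∂Pν with hv
  have he0 : 0 < ε.toReal := ENNReal.toReal_pos hε0.ne' (ne_top_of_lt hε)
  have hR0 : (0 : ℝ) < R := Nat.cast_pos.2 hR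
  obtain ⟨hg, hCg, -⟩ := centred_observable_bounds π hf hC
  have hψ : Measurable fun pq : (Ω × Bool) × (Ω × Bool) => f pq.1.1 - c :=
    hg.comp (measurable_fst.comp measurable_fst)
  -- the exact diagonal `E[Z_{i+1}²] = v`
  have hZ0sqI := splitChain_integrable_sq_tourSum κs (ν.map (fun y : Ω => (y, true))) (κ := κ)
    (ν := ν) (hmin := hmin) hε0 hε hκs hg hCg 0
  rw [← hPν] at hZ0sqI
  have hdiagE : ∀ k : ℕ, ∫ x, (∑' u, (if (∑ s ∈ Finset.range u,
      (if (x (s + 1)).2 then (1 : ℕ) else 0)) = k + 1 then (1 : ℝ) else 0) * (f (x u).1 - c)) ^ 2 ∂P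
      = v := fun k =>
    splitChain_tour_identically_distributed κs μs (κ := κ) (ν := ν) (hmin := hmin) hε0 hε hκs k
      (ψ₁ := fun p _ => f p.1 - c) (ψ₂ := fun p _ => f p.1 - c) hψ hψ (Λ := fun a _ => a ^ 2)
      (by norm_num) ((measurable_fst (α := ℝ) (β := ℝ)).pow_const 2) hZ0sqI
  -- second moments of `Σ Z_{i+1}` (now with `v`) and of `Σ (N_{i+1} − 1/e)`
  have hU := fun i i' => splitChain_centredTourSum_uncorrelated κs μs (κ := κ) (ν := ν) (hmin := hmin)
    hπ hε0 hε hκs hf hC i i'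
  obtain ⟨hZsqI, hZsq⟩ := integral_sq_sum_le_of_uncorrelated P
    (fun i x => ∑' u, (if (∑ s ∈ Finset.range u, (if (x (s + 1)).2 then (1 : ℕ) else 0)) = i + 1
      then (1 : ℝ) else 0) * (f (x u).1 - c)) R (v := v)
    (fun i _ i' _ => (hU i i').1) (fun i _ i' _ hne => (hU i i').2.1 hne)
    (fun i _ => le_of_eq (by rw [← hdiagE i]; exact integral_congr_ae (ae_of_all _ fun x => by ring)))
  have hV := fun i i' => splitChain_tourLength_uncorrelated κs μs (κ := κ) (ν := ν) (hmin := hmin)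
    hε0 hε hκs i i'
  obtain ⟨hNsqI, hNsq⟩ := integral_sq_sum_le_of_uncorrelated P
    (fun i x => (∑' u, (if (∑ s ∈ Finset.range u, (if (x (s + 1)).2 then (1 : ℕ) else 0)) = i + 1
      then (1 : ℝ) else 0)) - 1 / ε.toReal) R (v := (1 - ε.toReal) / ε.toReal ^ 2)
    (fun i _ i' _ => (hV i i').1) (fun i _ i' _ hne => (hV i i').2.1 hne)
    (fun i _ => (hV i i).2.2 rfl)
  have hZm : ∀ i, Measurable fun x : ℕ → Ω × Bool => ∑' u, (if (∑ s ∈ Finset.range u,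
      (if (x (s + 1)).2 then (1 : ℕ) else 0)) = i + 1 then (1 : ℝ) else 0) * (f (x u).1 - c) :=
    fun i => measurable_tourSum (Ω := Ω) (ψ := fun p _ => f p.1 - c) hψ (i + 1)
  have hNm : ∀ i, Measurable fun x : ℕ → Ω × Bool => (∑' u, (if (∑ s ∈ Finset.range u,
      (if (x (s + 1)).2 then (1 : ℕ) else 0)) = i + 1 then (1 : ℝ) else 0)) - 1 / ε.toReal :=
    fun i => (Measurable.tsum fun u => measurable_headCountIndicator u (i + 1)).sub_const _
  have hmemZ : MemLp (fun x : ℕ → Ω × Bool => ∑ i ∈ Finset.range R, ∑' u, (if (∑ s ∈ Finset.range u,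
      (if (x (s + 1)).2 then (1 : ℕ) else 0)) = i + 1 then (1 : ℝ) else 0) * (f (x u).1 - c)) 2 P :=
    (memLp_two_iff_integrable_sq (Finset.aestronglyMeasurable_fun_sum _ fun i _ =>
      (hZm i).aestronglyMeasurable)).2 hZsqI
  have hmemN : MemLp (fun x : ℕ → Ω × Bool => ∑ i ∈ Finset.range R, ((∑' u, (if (∑ s ∈ Finset.range u,
      (if (x (s + 1)).2 then (1 : ℕ) else 0)) = i + 1 then (1 : ℝ) else 0)) - 1 / ε.toReal)) 2 P :=
    (memLp_two_iff_integrable_sq (Finset.aestronglyMeasurable_fun_sum _ fun i _ =>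
      (hNm i).aestronglyMeasurable)).2 hNsqI
  have haZ : 0 < s * R / (2 * ε.toReal) := by positivity
  have haN : 0 < (R : ℝ) / (2 * ε.toReal) := by positivity
  have hChebZ : P.real {x : ℕ → Ω × Bool | s * R / (2 * ε.toReal) ≤ |∑ i ∈ Finset.range R, ∑' u,
      (if (∑ s ∈ Finset.range u, (if (x (s + 1)).2 then (1 : ℕ) else 0)) = i + 1
        then (1 : ℝ) else 0) * (f (x u).1 - c)|}
      ≤ (∫ x, (∑ i ∈ Finset.range R, ∑' u, (if (∑ s ∈ Finset.range u,
          (if (x (s + 1)).2 then (1 : ℕ) else 0)) = i + 1 then (1 : ℝ) else 0) * (f (x u).1 - c)) ^ 2 ∂P)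
          / (s * R / (2 * ε.toReal)) ^ 2 := by
    simpa only [sub_zero] using measureReal_abs_sub_ge_le hmemZ 0 haZ
  have hChebN : P.real {x : ℕ → Ω × Bool | (R : ℝ) / (2 * ε.toReal) ≤ |∑ i ∈ Finset.range R,
      ((∑' u, (if (∑ s ∈ Finset.range u, (if (x (s + 1)).2 then (1 : ℕ) else 0)) = i + 1
        then (1 : ℝ) else 0)) - 1 / ε.toReal)|}
      ≤ (∫ x, (∑ i ∈ Finset.range R, ((∑' u, (if (∑ s ∈ Finset.range u,
          (if (x (s + 1)).2 then (1 : ℕ) else 0)) = i + 1 then (1 : ℝ) else 0)) - 1 / ε.toReal)) ^ 2 ∂P)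
          / ((R : ℝ) / (2 * ε.toReal)) ^ 2 := by
    simpa only [sub_zero] using measureReal_abs_sub_ge_le hmemN 0 haN
  -- almost surely: outside both Chebyshev events the estimate is `s`-close
  have hae := splitChain_ae_tourStart κs μs (κ := κ) (ν := ν) (hmin := hmin) hε0 hε hκs
  rw [← hP] at hae
  have hincl : ∀ᵐ x ∂P, x ∈ {x : ℕ → Ω × Bool | s ≤ |(∑ i ∈ Finset.range R, ∑' u,
        (if (∑ s ∈ Finset.range u, (if (x (s + 1)).2 then (1 : ℕ) else 0)) = i + 1
          then (1 : ℝ) else 0) * f (x u).1)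
        / (∑ i ∈ Finset.range R, ∑' u, (if (∑ s ∈ Finset.range u,
          (if (x (s + 1)).2 then (1 : ℕ) else 0)) = i + 1 then (1 : ℝ) else 0)) - c|}
      → x ∈ {x : ℕ → Ω × Bool | s * R / (2 * ε.toReal) ≤ |∑ i ∈ Finset.range R, ∑' u,
          (if (∑ s ∈ Finset.range u, (if (x (s + 1)).2 then (1 : ℕ) else 0)) = i + 1
            then (1 : ℝ) else 0) * (f (x u).1 - c)|}
        ∪ {x : ℕ → Ω × Bool | (R : ℝ) / (2 * ε.toReal) ≤ |∑ i ∈ Finset.range R,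
          ((∑' u, (if (∑ s ∈ Finset.range u, (if (x (s + 1)).2 then (1 : ℕ) else 0)) = i + 1
            then (1 : ℝ) else 0)) - 1 / ε.toReal)|} := by
    filter_upwards [hae] with x hx hbad
    have hfin : ∀ i : ℕ, (∑' u, (if (∑ s ∈ Finset.range u, (if (x (s + 1)).2 then (1 : ℕ) else 0))
          = i + 1 then (1 : ℝ) else 0) * (f (x u).1 - c))
        = (∑' u, (if (∑ s ∈ Finset.range u, (if (x (s + 1)).2 then (1 : ℕ) else 0)) = i + 1
            then (1 : ℝ) else 0) * f (x u).1)
          - c * (∑' u, (if (∑ s ∈ Finset.range u, (if (x (s + 1)).2 then (1 : ℕ) else 0))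
            = i + 1 then (1 : ℝ) else 0)) := by
      intro i
      obtain ⟨t₁, ht₁, hh₁⟩ := hx (i + 1)
      rw [tourSum_eq_finsetSum (fun p _ => f p.1 - c) x le_rfl ht₁ hh₁,
        tourSum_eq_finsetSum (fun p _ => f p.1) x le_rfl ht₁ hh₁,
        tourLength_eq_finsetSum x le_rfl ht₁ hh₁, Finset.mul_sum, ← Finset.sum_sub_distrib]
      exact Finset.sum_congr rfl fun u _ => by ring
    set SY := ∑ i ∈ Finset.range R, ∑' u, (if (∑ s ∈ Finset.range u,
      (if (x (s + 1)).2 then (1 : ℕ) else 0)) = i + 1 then (1 : ℝ) else 0) * f (x u).1 with hSY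
    set SN := ∑ i ∈ Finset.range R, ∑' u, (if (∑ s ∈ Finset.range u,
      (if (x (s + 1)).2 then (1 : ℕ) else 0)) = i + 1 then (1 : ℝ) else 0) with hSN
    have hSZ : ∑ i ∈ Finset.range R, ∑' u, (if (∑ s ∈ Finset.range u,
        (if (x (s + 1)).2 then (1 : ℕ) else 0)) = i + 1 then (1 : ℝ) else 0) * (f (x u).1 - c)
        = SY - c * SN := by
      rw [Finset.sum_congr rfl fun i _ => hfin i, Finset.sum_sub_distrib, ← Finset.mul_sum]
    have hSM : ∑ i ∈ Finset.range R, ((∑' u, (if (∑ s ∈ Finset.range u,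
        (if (x (s + 1)).2 then (1 : ℕ) else 0)) = i + 1 then (1 : ℝ) else 0)) - 1 / ε.toReal)
        = SN - R / ε.toReal := by
      rw [Finset.sum_sub_distrib, Finset.sum_const, Finset.card_range, nsmul_eq_mul]
      ring
    by_contra hnot
    simp only [Set.mem_union, Set.mem_setOf_eq, not_or, not_le] at hnot
    obtain ⟨hZlt, hNlt⟩ := hnot
    rw [hSZ] at hZlt
    rw [hSM] at hNlt
    have hSNlow : (R : ℝ) / (2 * ε.toReal) < SN := by
      have := neg_lt_of_abs_lt hNlt
      have hRe : (R : ℝ) / ε.toReal = 2 * ((R : ℝ) / (2 * ε.toReal)) := by field_simp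
      linarith
    have hkey : s * SN ≤ |SY - c * SN| := by
      have hSN0 : 0 < SN := haN.trans hSNlow
      have h1 : SY - c * SN = (SY / SN - c) * SN := by field_simp
      rw [h1, abs_mul, abs_of_pos hSN0]
      exact mul_le_mul_of_nonneg_right hbad hSN0.le
    have h2 : s * ((R : ℝ) / (2 * ε.toReal)) < s * SN := mul_lt_mul_of_pos_left hSNlow hs
    have h3 : s * ((R : ℝ) / (2 * ε.toReal)) = s * R / (2 * ε.toReal) := by ring
    linarith
  have hv0 : 0 ≤ v := integral_nonneg fun x => sq_nonneg _
  -- assemble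
  calc P.real _ ≤ P.real ({x : ℕ → Ω × Bool | s * R / (2 * ε.toReal) ≤ |∑ i ∈ Finset.range R, ∑' u,
          (if (∑ s ∈ Finset.range u, (if (x (s + 1)).2 then (1 : ℕ) else 0)) = i + 1
            then (1 : ℝ) else 0) * (f (x u).1 - c)|}
        ∪ {x : ℕ → Ω × Bool | (R : ℝ) / (2 * ε.toReal) ≤ |∑ i ∈ Finset.range R,
          ((∑' u, (if (∑ s ∈ Finset.range u, (if (x (s + 1)).2 then (1 : ℕ) else 0)) = i + 1
            then (1 : ℝ) else 0)) - 1 / ε.toReal)|}) :=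
        ENNReal.toReal_mono (measure_ne_top _ _) (measure_mono_ae hincl)
    _ ≤ _ := measureReal_union_le _ _
    _ ≤ (R * v) / (s * R / (2 * ε.toReal)) ^ 2
        + (R * ((1 - ε.toReal) / ε.toReal ^ 2)) / ((R : ℝ) / (2 * ε.toReal)) ^ 2 :=
        add_le_add (hChebZ.trans (div_le_div_of_nonneg_right hZsq (by positivity)))
          (hChebN.trans (div_le_div_of_nonneg_right hNsq (by positivity)))
    _ = 4 * (ε.toReal * (ε.toReal * v) / s ^ 2 + (1 - ε.toReal)) / R := by
        field_simp
        ring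

end Sigma

end Summit.Ventures.LatticeQCDFlow.Scoring

end
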